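/-
Copyright: the b2b-balaban T⁴-continuum CRUX team, row NE7b leaf lineage `t4-ne7b-formalise-leaf-03` (gen 152). Project licence.
-/
import Summits.QuantumFields.BalabanUV.T4Continuum.Spine.NE7b.OneShotChartConcentration
import Summits.QuantumFields.BalabanUV.T4Continuum.Spine.NE7b.OneShotChartFibreChain

/-!
# THE η-ℓ² ONE-SHOT CHART CONSTANT *IS* `sup_{p∈[−π,π]^d} Σ_kU_k(p)R_k(p)²∕X(p)²` — the `≥` direction by Fejér concentration, and the
# two-sided statement (row NE7b, node U5c; [folklore] Fourier analysis of the scalar free field's one-shot section; nothing of Bałaban's)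

Cell `pub-balaban`, sub-cell `t4`, spine estimate NE7b (`T4WeightBudget.RelWeightBound`; the cell's OWN estimate — NOT PRINTED in
[Bałaban 1983–89], NOT PROVED).  Crux-route work under `Spine/NE7b/` by leaf-03 (CRUX team (2), FREEZE (0) crux-prover clause, gen 152),
FILING-CLAIM C-leaf03-g152-SHARP (journal [NE7bLEAF03-G152-ONLINE]).  NOTHING of Bałaban's is asserted; no `T4Continuum/Support` leaf; no
`def`; zero `sorry`.  Used BY NAME: the OWNER's (40) `OneShotChartFibreSum` (`sum_normSq_G`, `symbR_eq_div`, `Er_pos`, `Rr_zero`), (42)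
`OneShotChartBound.tsum_HB_sq_le_sharp`, (43) `OneShotChartFibreChain.tsum_HB_sq_le_of_fibre` ∕ `tsum_HBZd_sq_le_of_fibre` (the `≤` direction),
this lineage's OSFI `OneShotChartFibreIdentity.fibreMultiplier_eq` and `OneShotChartConcentration` (the concentration estimate + mediant).

WHY.  The OWNER's (42) (`(π²∕4)^d`), (44) (`M = 2`), (45) (`M ≥ 3`) and this lineage's OSFU (`(5∕3)^d`, every `M`) are UPPER bounds for the
η-ℓ² chart constant of the free one-shot section `H_M`; OSFI turned `((n+1)^d)⁻¹Σ′(HB)²` into the fibre ratio `S₂∕S² = Σ_kU_kR_k²∕X²` integrated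
against `|B̂|²`, and both (42) and OSFI list «the `≥` direction ∕ `sup_p S₂∕S²` as the exact operator norm» as NOT typed.  This file types
it: the pricing desk's instrument-5 truth (`‖H_M‖²_η = 1.088², …, sup 1.326²` at d = 4, PRICING-NE7b v120 F713 ∕ v122 F726) is now a TWO-SIDED
kernel statement about the explicit continuous function `p ↦ Σ_kU_k(p)R_k(p)²∕X(p)²` on `[−π,π]^d` — its supremum IS the constant; a calc
seat may enclose it, no bound can beat it.

WHAT IS PROVED ([folklore]; `n : ℕ` the mesh — block side `n+1` —, `a > 0`):
* §4 **`exists_HB_ratio_ge_of_interior`** ∕ **`exists_HB_ratio_ge`**: for every `p₀ ∈ [−π,π]^d` and every `K < Σ_kU_k(p₀)R_k(p₀)²∕X(p₀)²`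
  there are a finite window `T` and a REAL field `B` with `0 < Σ_T B²` and `K·Σ_T B² ≤ ((n+1)^d)⁻¹·Σ′_z(Σ_{y∈T}B(y)H(z,y))²` (Fejér
  concentration of the complex packet `e^{ip₀·y}` on a box `[0,m+1)^d` — masses by Parseval, far mass `O((m+1)^{d−1})`, multiplier
  continuous; then the real or the imaginary part; boundary centres by shrinking `p₀ ↦ (1−t)p₀`).
* §5 **`chart_letter_iff`**: `(∀ T B: ((n+1)^d)⁻¹Σ′(HB)² ≤ K·Σ_T B²) ↔ (∀ p ∈ [−π,π]^d: Σ_kU_kR_k²∕X² ≤ K)` — THE CHART CONSTANT *IS*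
  `sup_{[−π,π]^d} Σ_kU_kR_k²∕X²` (`←` = (43) + OSFI by name, `fibre_hyp_of_ratio_le`); **`chart_letter_l2_iff`** — the same for square-summable
  `B` (the shape of (42) `tsum_HBZd_sq_le_uniform_sharp` ∕ OSFU `tsum_HBZd_sq_le_uniform_eta`); `Ur_at_zero`, `fibreRatio_zero` (the ratio is
  `1` at `p = 0`), **`one_le_of_chart_letter`** (no constant below `1` for any side).
* §6 **`exists_isLeast_chart_constant`** ∕ `…_l2`: the LEAST constant exists and equals the fibre ratio at some `p⋆ ∈ [−π,π]^d` — the supremum is a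
  MAXIMUM (the multiplier is continuous on the compact zone, `IsCompact.exists_isMaxOn`).

NOT HERE (honest): the VALUE of the supremum (a calc enclosure of an explicit function; d = 4 desk truth `1.326²`); evenness ∕ periodicity of
the ratio; the sup ∕ mixed currencies ((46)–(50), PRICING F727); the torus; anything of Bałaban's ((A3), NC-NE7b-α UNRULED).  BY-NAME EFFECT ON
THE WALL: NONE — the chart LETTER `K(M) < M^{(d−2)∕2}` was already BY PROOF; this closes the constant's characterisation.  NE7b NOT PRINTED ∕
NOT PROVED; spine PROVED 0∕9; rung (B)+1 on a FINITE torus — NOT infinite volume, NOT the mass gap, NOT Clay.  HONEST DEPENDENCY: continuum YM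
on T⁴ ⇐ BetaPertH ∧ nine spine estimates (0∕9 proved); BetaPertH ⇐ (D1) ∧ (D4) ∧ CAP+tail; G-an2-4 gates asym, D1 and NE2∕3∕4.
-/

set_option autoImplicit false

namespace Summit.QuantumFields.BalabanUV.T4Continuum.NE7b.OneShotChartFibreSharp

open Finset Complex MeasureTheory Filter Topology Set
open Literature.MathematicalPhysics.QuantumFieldTheory.Balaban1983to89
open B4Strip (ofRealVec Ur Er S1r uFactorr)
open B4StripSums (G)
open B4ContourShift (BZ)
open B6QGQLower276 (X B chart)
open B6QGQDecay237 (card_B)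
open B5Hk103ScalarZd (kerH)
open B5Hk103Minimizer (HB)
open B5Hk165L2Zd (HBZd)
open B5Momentum166Zd (isCompact_BZ measurableSet_BZ)
open B5Ineq167SymbolZd (phase)
open B6QGQFourier275Zd (symbQGQ symbR Rr Xr Xr_ge)
open OneShotChartFibreSum (sum_normSq_G symbR_eq_div Er_pos Rr_zero)
open OneShotChartBound (tsum_HB_sq_le_sharp)
open OneShotChartFibreChain (tsum_HB_sq_le_of_fibre tsum_HBZd_sq_le_of_fibre)
open OneShotChartFibreIdentity (fibreMultiplier_eq)
open OneShotChartConcentration (continuousOn_mult tsum_normSq_Hc_packet_ge normSq_Hc_packet_eq sum_cos_sq_add_sin_sq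
  tsum_HB_sq_eq_zero_of_sum_sq_eq_zero mediant)
open scoped Real

noncomputable section

variable {d : ℕ}

/-! ## §4. THE `≥` DIRECTION: every value of the fibre ratio on the zone is (nearly) attained by a real, finitely supported field -/

/-- `d·(m+1)^{d−1}·(m+1) = d·(m+1)^d` (also for `d = 0`). [folklore] -/
theorem d_mul_pow_pred (m : ℕ) : (d : ℝ) * ((m : ℝ) + 1) ^ (d - 1) * ((m : ℝ) + 1) = (d : ℝ) * ((m : ℝ) + 1) ^ d := by
  rcases Nat.eq_zero_or_pos d with hd | hd
  · subst hd; simp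
  · obtain ⟨k, rfl⟩ : ∃ k, d = k + 1 := ⟨d - 1, by omega⟩
    rw [Nat.add_sub_cancel, pow_succ]
    ring

/-- **INTERIOR CENTRES**: for `p₀` with `|p₀_μ| ≤ π − ρ` (`ρ > 0`) and every `K < Σ_kU_k(p₀)R_k(p₀)²∕X(p₀)²`, some REAL field `B` on a finite
window `T` has `0 < Σ_T B²` and `K·Σ_T B² ≤ ((n+1)^d)⁻¹·Σ′_z (H B)(z)²`. [folklore] -/
theorem exists_HB_ratio_ge_of_interior (n : ℕ) {a : ℝ} (ha : 0 < a) (p₀ : Fin d → ℝ) (hp₀BZ : p₀ ∈ BZ d) {ρ : ℝ}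
    (hρ : 0 < ρ) (hp₀ : ∀ μ, |p₀ μ| ≤ π - ρ) {K : ℝ}
    (hK : K < (∑ k : Fin d → Fin (n + 1), Ur (n + 1) k p₀ * Rr (n + 1) k p₀ ^ 2) / Xr (n + 1) p₀ ^ 2) :
    ∃ (T : Finset (X d)) (Bf : X d → ℝ), 0 < ∑ y ∈ T, Bf y ^ 2 ∧
      K * ∑ y ∈ T, Bf y ^ 2 ≤ (((n : ℝ) + 1) ^ d)⁻¹ * ∑' z : X d, HB n a T Bf z ^ 2 := by
  have hN : (0 : ℝ) < ((n : ℝ) + 1) ^ d := by positivity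
  -- trivial constants
  by_cases hK0 : K ≤ 0
  · refine ⟨{0}, fun _ => 1, by simp, ?_⟩
    have h1 : (0 : ℝ) ≤ (((n : ℝ) + 1) ^ d)⁻¹ * ∑' z : X d, HB n a {0} (fun _ => (1 : ℝ)) z ^ 2 :=
      mul_nonneg (inv_nonneg.mpr hN.le) (tsum_nonneg fun z => sq_nonneg _)
    refine le_trans ?_ h1
    rw [Finset.sum_singleton, one_pow, mul_one]
    exact hK0
  push Not at hK0
  -- the multiplier at `p₀` and the target in the un-normalised currency
  set M : (Fin d → ℝ) → ℝ := fun p =>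
    ∑ τ : Fin d → Fin (n + 1), ‖G (n + 1) a 0 τ (ofRealVec p) / symbQGQ (n + 1) a (ofRealVec p)‖ ^ 2 with hM
  have hMp₀ : M p₀ = ((n : ℝ) + 1) ^ d *
      ((∑ k : Fin d → Fin (n + 1), Ur (n + 1) k p₀ * Rr (n + 1) k p₀ ^ 2) / Xr (n + 1) p₀ ^ 2) := by
    simp only [hM]; rw [fibreMultiplier_eq n ha p₀ hp₀BZ]; ring
  set Kt : ℝ := ((n : ℝ) + 1) ^ d * K with hKt
  have hKtlt : Kt < M p₀ := by rw [hMp₀, hKt]; exact mul_lt_mul_of_pos_left hK hN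
  have hKt0 : 0 < Kt := by positivity
  set ε : ℝ := (M p₀ - Kt) / 2 with hε
  have hε0 : 0 < ε := by simp only [hε]; linarith
  have hεM : ε ≤ M p₀ := by simp only [hε]; linarith
  -- continuity of the multiplier at `p₀` within the zone
  obtain ⟨δ₀, hδ₀, hcont⟩ := Metric.continuousWithinAt_iff.mp (continuousOn_mult n ha p₀ hp₀BZ) ε hε0
  set δ : ℝ := min δ₀ ρ with hδdef
  have hδ : 0 < δ := lt_min hδ₀ hρ
  have hδρ : δ ≤ ρ := min_le_right _ _
  have hnear : ∀ p ∈ BZ d, (∀ μ, |p μ - p₀ μ| < δ) → M p₀ - ε ≤ M p := by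
    intro p hp hμ
    have hdist : dist p p₀ < δ₀ := by
      refine lt_of_lt_of_le ((dist_pi_lt_iff hδ).mpr fun μ => ?_) (min_le_left _ _)
      rw [Real.dist_eq]; exact hμ μ
    have h := hcont hp hdist
    rw [Real.dist_eq] at h
    have := (abs_lt.mp h).1
    simp only [hM] at this ⊢
    linarith
  -- choose the box side
  obtain ⟨m, hm⟩ := exists_nat_ge ((M p₀ - ε) * (π ^ 2 / δ ^ 2 * d) / (M p₀ - ε - Kt))
  have hgap : 0 < M p₀ - ε - Kt := by simp only [hε]; linarith
  have hm' : (M p₀ - ε) * (π ^ 2 / δ ^ 2 * d) ≤ (M p₀ - ε - Kt) * ((m : ℝ) + 1) := by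
    rw [div_le_iff₀ hgap] at hm
    nlinarith
  -- the packet estimate
  have hpk := tsum_normSq_Hc_packet_ge n ha p₀ hδ hδρ hp₀ hεM hnear m
  have hX : (0 : ℝ) < ((m : ℝ) + 1) ^ d := by positivity
  have hkey : Kt * ((m : ℝ) + 1) ^ d ≤ (M p₀ - ε) * (((m : ℝ) + 1) ^ d - π ^ 2 / δ ^ 2 * (d * ((m : ℝ) + 1) ^ (d - 1))) := by
    -- multiply the target by `m + 1 > 0` and use `d(m+1)^{d-1}(m+1) = d(m+1)^d`
    have hm1 : (0 : ℝ) < (m : ℝ) + 1 := by positivity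
    refine le_of_mul_le_mul_right ?_ hm1
    have hexp : (M p₀ - ε) * (((m : ℝ) + 1) ^ d - π ^ 2 / δ ^ 2 * (d * ((m : ℝ) + 1) ^ (d - 1))) * ((m : ℝ) + 1)
        = (M p₀ - ε) * ((m : ℝ) + 1) ^ d * ((m : ℝ) + 1) - (M p₀ - ε) * (π ^ 2 / δ ^ 2 * d) * ((m : ℝ) + 1) ^ d := by
      have := d_mul_pow_pred (d := d) m
      calc (M p₀ - ε) * (((m : ℝ) + 1) ^ d - π ^ 2 / δ ^ 2 * (d * ((m : ℝ) + 1) ^ (d - 1))) * ((m : ℝ) + 1)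
          = (M p₀ - ε) * ((m : ℝ) + 1) ^ d * ((m : ℝ) + 1)
              - (M p₀ - ε) * (π ^ 2 / δ ^ 2) * ((d : ℝ) * ((m : ℝ) + 1) ^ (d - 1) * ((m : ℝ) + 1)) := by ring
        _ = _ := by rw [this]; ring
    rw [hexp]
    have h2 : (M p₀ - ε) * (π ^ 2 / δ ^ 2 * d) * ((m : ℝ) + 1) ^ d ≤ (M p₀ - ε - Kt) * ((m : ℝ) + 1) * ((m : ℝ) + 1) ^ d :=
      mul_le_mul_of_nonneg_right hm' hX.le
    nlinarith
  have hmain : Kt * ((m : ℝ) + 1) ^ d ≤ ∑' z : X d, ‖∑ y ∈ B m 0, cexp (I * ((phase p₀ y : ℝ) : ℂ)) * (kerH n a z y : ℂ)‖ ^ 2 :=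
    hkey.trans hpk
  -- split into the cosine and the sine fields
  set B₁ : X d → ℝ := fun y => Real.cos (phase p₀ y) with hB₁
  set B₂ : X d → ℝ := fun y => Real.sin (phase p₀ y) with hB₂
  have hS₁ := (tsum_HB_sq_le_sharp n ha (B m 0) B₁).1
  have hS₂ := (tsum_HB_sq_le_sharp n ha (B m 0) B₂).1
  have hsplit : ∑' z : X d, ‖∑ y ∈ B m 0, cexp (I * ((phase p₀ y : ℝ) : ℂ)) * (kerH n a z y : ℂ)‖ ^ 2
      = ∑' z : X d, HB n a (B m 0) B₁ z ^ 2 + ∑' z : X d, HB n a (B m 0) B₂ z ^ 2 := by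
    rw [← hS₁.tsum_add hS₂]
    exact tsum_congr fun z => normSq_Hc_packet_eq n a (B m 0) p₀ z
  have hmass : ∑ y ∈ B m 0, B₁ y ^ 2 + ∑ y ∈ B m 0, B₂ y ^ 2 = ((m : ℝ) + 1) ^ d := by
    simp only [hB₁, hB₂]; rw [sum_cos_sq_add_sin_sq, card_B]
  rw [hsplit, ← hmass] at hmain
  rcases mediant hmain (by rw [hmass]; exact hX) (Finset.sum_nonneg fun y _ => sq_nonneg _)
      (Finset.sum_nonneg fun y _ => sq_nonneg _) (tsum_HB_sq_eq_zero_of_sum_sq_eq_zero n a _ B₁)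
      (tsum_HB_sq_eq_zero_of_sum_sq_eq_zero n a _ B₂) with ⟨hb, hkb⟩ | ⟨hb, hkb⟩
  · refine ⟨B m 0, B₁, hb, ?_⟩
    rw [hKt] at hkb
    calc K * ∑ y ∈ B m 0, B₁ y ^ 2 = (((n : ℝ) + 1) ^ d)⁻¹ * (((n : ℝ) + 1) ^ d * K * ∑ y ∈ B m 0, B₁ y ^ 2) := by
          field_simp
      _ ≤ (((n : ℝ) + 1) ^ d)⁻¹ * ∑' z : X d, HB n a (B m 0) B₁ z ^ 2 :=
          mul_le_mul_of_nonneg_left hkb (inv_nonneg.mpr hN.le)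
  · refine ⟨B m 0, B₂, hb, ?_⟩
    rw [hKt] at hkb
    calc K * ∑ y ∈ B m 0, B₂ y ^ 2 = (((n : ℝ) + 1) ^ d)⁻¹ * (((n : ℝ) + 1) ^ d * K * ∑ y ∈ B m 0, B₂ y ^ 2) := by
          field_simp
      _ ≤ (((n : ℝ) + 1) ^ d)⁻¹ * ∑' z : X d, HB n a (B m 0) B₂ z ^ 2 :=
          mul_le_mul_of_nonneg_left hkb (inv_nonneg.mpr hN.le)


/-- **THE `≥` DIRECTION FOR EVERY CENTRE OF THE ZONE**: for every `n`, `a > 0`, `p₀ ∈ [−π,π]^d` and every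
`K < Σ_kU_k(p₀)R_k(p₀)²∕X(p₀)²` there are a finite window `T` and a REAL field `B` with `0 < Σ_T B²` and
`K·Σ_T B² ≤ ((n+1)^d)⁻¹·Σ′_z (Σ_{y∈T}B(y)H(z,y))²` — boundary centres by shrinking toward `0` and continuity of the multiplier. [folklore] -/
theorem exists_HB_ratio_ge (n : ℕ) {a : ℝ} (ha : 0 < a) (p₀ : Fin d → ℝ) (hp₀ : p₀ ∈ BZ d) {K : ℝ}
    (hK : K < (∑ k : Fin d → Fin (n + 1), Ur (n + 1) k p₀ * Rr (n + 1) k p₀ ^ 2) / Xr (n + 1) p₀ ^ 2) :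
    ∃ (T : Finset (X d)) (Bf : X d → ℝ), 0 < ∑ y ∈ T, Bf y ^ 2 ∧
      K * ∑ y ∈ T, Bf y ^ 2 ≤ (((n : ℝ) + 1) ^ d)⁻¹ * ∑' z : X d, HB n a T Bf z ^ 2 := by
  have hN : (0 : ℝ) < ((n : ℝ) + 1) ^ d := by positivity
  have hpi := Real.pi_pos
  set M : (Fin d → ℝ) → ℝ := fun p =>
    ∑ τ : Fin d → Fin (n + 1), ‖G (n + 1) a 0 τ (ofRealVec p) / symbQGQ (n + 1) a (ofRealVec p)‖ ^ 2 with hM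
  have hmM : ∀ p ∈ BZ d, (∑ k : Fin d → Fin (n + 1), Ur (n + 1) k p * Rr (n + 1) k p ^ 2) / Xr (n + 1) p ^ 2
      = M p / ((n : ℝ) + 1) ^ d := fun p hp => by
    simp only [hM]; rw [fibreMultiplier_eq n ha p hp]; field_simp
  have hKM : ((n : ℝ) + 1) ^ d * K < M p₀ := by
    have h := hmM p₀ hp₀
    rw [h, lt_div_iff₀ hN] at hK
    linarith
  obtain ⟨δ₀, hδ₀, hcont⟩ :=
    Metric.continuousWithinAt_iff.mp (continuousOn_mult n ha p₀ hp₀) (M p₀ - ((n : ℝ) + 1) ^ d * K) (by linarith)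
  -- shrink the centre toward the origin
  set t : ℝ := min (1 / 2) (δ₀ / (2 * π)) with ht
  have ht0 : 0 < t := lt_min (by norm_num) (by positivity)
  have ht1 : t ≤ 1 / 2 := min_le_left _ _
  have htπ : t * π < δ₀ := by
    calc t * π ≤ δ₀ / (2 * π) * π := mul_le_mul_of_nonneg_right (min_le_right _ _) hpi.le
      _ = δ₀ / 2 := by field_simp
      _ < δ₀ := by linarith
  set p₁ : Fin d → ℝ := fun μ => (1 - t) * p₀ μ with hp₁
  have hp₀μ : ∀ μ, |p₀ μ| ≤ π := fun μ => abs_le.mpr ⟨hp₀.1 μ, hp₀.2 μ⟩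
  have hp₁μ : ∀ μ, |p₁ μ| ≤ π - t * π := fun μ => by
    simp only [hp₁]
    rw [abs_mul, abs_of_pos (by linarith)]
    nlinarith [hp₀μ μ]
  have hp₁BZ : p₁ ∈ BZ d :=
    ⟨fun μ => (abs_le.mp ((hp₁μ μ).trans (by nlinarith))).1, fun μ => (abs_le.mp ((hp₁μ μ).trans (by nlinarith))).2⟩
  have hdist : dist p₁ p₀ < δ₀ := by
    refine (dist_pi_lt_iff hδ₀).mpr fun μ => ?_
    rw [Real.dist_eq]
    simp only [hp₁]
    calc |(1 - t) * p₀ μ - p₀ μ| = t * |p₀ μ| := by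
          rw [show (1 - t) * p₀ μ - p₀ μ = -(t * p₀ μ) by ring, abs_neg, abs_mul, abs_of_pos ht0]
      _ ≤ t * π := mul_le_mul_of_nonneg_left (hp₀μ μ) ht0.le
      _ < δ₀ := htπ
  have h1 := hcont hp₁BZ hdist
  rw [Real.dist_eq] at h1
  have hK₁ : K < (∑ k : Fin d → Fin (n + 1), Ur (n + 1) k p₁ * Rr (n + 1) k p₁ ^ 2) / Xr (n + 1) p₁ ^ 2 := by
    rw [hmM p₁ hp₁BZ, lt_div_iff₀ hN]
    have := (abs_lt.mp h1).1
    linarith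
  exact exists_HB_ratio_ge_of_interior n ha p₁ hp₁BZ (by positivity : 0 < t * π) hp₁μ hK₁

/-! ## §5. THE CHART CONSTANT IS `sup_{[−π,π]^d}` OF THE FIBRE RATIO: the two-sided statement, on finite windows and on `ℓ²` -/

/-- `X(p) > 0` on the zone. [folklore] -/
theorem Xr_pos (n : ℕ) (p : Fin d → ℝ) (hp : p ∈ BZ d) : 0 < Xr (n + 1) p :=
  lt_of_lt_of_le (by positivity) (Xr_ge (n + 1) (by omega) p fun μ => abs_le.mpr ⟨hp.1 μ, hp.2 μ⟩)

/-- a bound on the fibre ratio is the fibre hypothesis of the OWNER's (43) chain. [folklore] -/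
theorem fibre_hyp_of_ratio_le (n : ℕ) {a : ℝ} (ha : 0 < a) {K : ℝ}
    (hm : ∀ p ∈ BZ d, (∑ k : Fin d → Fin (n + 1), Ur (n + 1) k p * Rr (n + 1) k p ^ 2) / Xr (n + 1) p ^ 2 ≤ K) :
    ∀ p ∈ BZ d, ∑ τ : Fin d → Fin (n + 1), ‖G (n + 1) a 0 τ (ofRealVec p)‖ ^ 2
      ≤ ((n : ℝ) + 1) ^ d * K * symbR (n + 1) a p ^ 2 := by
  intro p hp
  have hE := Er_pos (n + 1) (by omega) ha p hp
  have hX := Xr_pos n p hp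
  have h1 := hm p hp
  rw [div_le_iff₀ (by positivity)] at h1
  rw [sum_normSq_G (n + 1) (by omega) a p hp, symbR_eq_div]
  push_cast
  rw [div_pow, mul_div_assoc, mul_assoc]
  refine mul_le_mul_of_nonneg_left ?_ (by positivity)
  rw [div_le_iff₀ (by positivity)]
  calc ∑ k : Fin d → Fin (n + 1), Ur (n + 1) k p * Rr (n + 1) k p ^ 2 ≤ K * Xr (n + 1) p ^ 2 := h1
    _ = K * (Xr (n + 1) p ^ 2 / Er (n + 1) a 0 p ^ 2) * Er (n + 1) a 0 p ^ 2 := by field_simp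

/-- **THE ONE-SHOT CHART CONSTANT, TWO-SIDED (finite windows)**: for every `n`, `a > 0` and every real `K`,
`(∀ T B: ((n+1)^d)⁻¹·Σ′_z (Σ_{y∈T}B(y)H(z,y))² ≤ K·Σ_{y∈T}B(y)²) ↔ (∀ p ∈ [−π,π]^d: Σ_kU_k(p)R_k(p)²∕X(p)² ≤ K)` — i.e.
`‖H_{n+1}‖²_{ℓ²→ℓ²_η} = sup_{[−π,π]^d} Σ_kU_kR_k²∕X²` EXACTLY (`←` is the OWNER's (43) `tsum_HB_sq_le_of_fibre`, `→` is §4). [folklore] -/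
theorem chart_letter_iff (n : ℕ) {a : ℝ} (ha : 0 < a) (K : ℝ) :
    (∀ (T : Finset (X d)) (Bf : X d → ℝ),
        (((n : ℝ) + 1) ^ d)⁻¹ * ∑' z : X d, HB n a T Bf z ^ 2 ≤ K * ∑ y ∈ T, Bf y ^ 2)
      ↔ ∀ p ∈ BZ d, (∑ k : Fin d → Fin (n + 1), Ur (n + 1) k p * Rr (n + 1) k p ^ 2) / Xr (n + 1) p ^ 2 ≤ K := by
  have hN : (0 : ℝ) < ((n : ℝ) + 1) ^ d := by positivity
  constructor
  · intro h p hp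
    by_contra hlt
    push Not at hlt
    obtain ⟨T, Bf, hpos, hge⟩ := exists_HB_ratio_ge n ha p hp
      (K := (K + (∑ k : Fin d → Fin (n + 1), Ur (n + 1) k p * Rr (n + 1) k p ^ 2) / Xr (n + 1) p ^ 2) / 2) (by linarith)
    have h2 := h T Bf
    nlinarith
  · intro hm T Bf
    have h2 := (tsum_HB_sq_le_of_fibre n ha (fibre_hyp_of_ratio_le n ha hm) T Bf).2
    calc (((n : ℝ) + 1) ^ d)⁻¹ * ∑' z : X d, HB n a T Bf z ^ 2
        ≤ (((n : ℝ) + 1) ^ d)⁻¹ * (((n : ℝ) + 1) ^ d * K * ∑ y ∈ T, Bf y ^ 2) :=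
          mul_le_mul_of_nonneg_left h2 (inv_nonneg.mpr hN.le)
      _ = K * ∑ y ∈ T, Bf y ^ 2 := by field_simp

/-- `|u(0 + 2πk)|² = δ_{k,0}`: at zero momentum only the central alias survives. [folklore] -/
theorem Ur_at_zero (N : ℕ) [NeZero N] (k : Fin d → Fin N) :
    Ur N k (0 : Fin d → ℝ) = if k = fun _ => (0 : Fin N) then 1 else 0 := by
  unfold Ur
  split_ifs with hk
  · subst hk; simp [uFactorr]
  · obtain ⟨μ, hμ⟩ : ∃ μ, k μ ≠ 0 := by
      by_contra h
      push Not at h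
      exact hk (funext h)
    refine Finset.prod_eq_zero (Finset.mem_univ μ) ?_
    have hk' : (k μ : ℕ) ≠ 0 := fun h => hμ (Fin.ext (by rw [h]; simp))
    simp [uFactorr, hk', S1r]

/-- **the fibre ratio at `p = 0` is `1`** (`U_k(0) = δ_{k,0}`, `R_0 = 1`). [folklore] -/
theorem fibreRatio_zero (N : ℕ) [NeZero N] :
    (∑ k : Fin d → Fin N, Ur N k (0 : Fin d → ℝ) * Rr N k (0 : Fin d → ℝ) ^ 2) / Xr N (0 : Fin d → ℝ) ^ 2 = 1 := by
  unfold Xr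
  simp_rw [Ur_at_zero, ite_mul, one_mul, zero_mul, Finset.sum_ite_eq', Finset.mem_univ, if_true, Rr_zero]
  norm_num

/-- **FLOOR**: any constant in the chart letter is at least `1` (test the letter at the zero mode). [folklore] -/
theorem one_le_of_chart_letter (n : ℕ) {a : ℝ} (ha : 0 < a) {K : ℝ}
    (h : ∀ (T : Finset (X d)) (Bf : X d → ℝ),
      (((n : ℝ) + 1) ^ d)⁻¹ * ∑' z : X d, HB n a T Bf z ^ 2 ≤ K * ∑ y ∈ T, Bf y ^ 2) : 1 ≤ K := by
  have hz : (0 : Fin d → ℝ) ∈ BZ d := ⟨fun _ => by simp [Real.pi_pos.le], fun _ => by simp [Real.pi_pos.le]⟩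
  have h0 := (chart_letter_iff n ha K).mp h 0 hz
  rwa [fibreRatio_zero] at h0

/-- **THE ONE-SHOT CHART CONSTANT, TWO-SIDED (square-summable fields; the shape of (42) `tsum_HBZd_sq_le_uniform_sharp`)**:
`(∀ B ∈ ℓ²(ℤ^d): ((n+1)^d)⁻¹·Σ′_z (H B)(z)² ≤ K·Σ′_y B(y)²) ↔ (∀ p ∈ [−π,π]^d: Σ_kU_k(p)R_k(p)²∕X(p)² ≤ K)` — the best constant in
the OWNER's (42) ∕ this lineage's OSFU is `sup_{[−π,π]^d} Σ_kU_kR_k²∕X²`, no smaller. [folklore] -/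
theorem chart_letter_l2_iff (n : ℕ) {a : ℝ} (ha : 0 < a) (K : ℝ) :
    (∀ Bf : X d → ℝ, Summable (fun x => Bf x ^ 2) →
        (((n : ℝ) + 1) ^ d)⁻¹ * ∑' z : X d, HBZd n a Bf z ^ 2 ≤ K * ∑' y : X d, Bf y ^ 2)
      ↔ ∀ p ∈ BZ d, (∑ k : Fin d → Fin (n + 1), Ur (n + 1) k p * Rr (n + 1) k p ^ 2) / Xr (n + 1) p ^ 2 ≤ K := by
  have hN : (0 : ℝ) < ((n : ℝ) + 1) ^ d := by positivity
  constructor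
  · intro h
    refine (chart_letter_iff n ha K).mp fun T Bf => ?_
    -- truncate `B` to the window `T`
    have hzero : ∀ y ∉ T, (fun y => if y ∈ T then Bf y else 0) y ^ 2 = 0 := fun y hy => by simp [hy]
    have hS : Summable fun y => (fun y => if y ∈ T then Bf y else 0) y ^ 2 := summable_of_ne_finset_zero hzero
    have h1 : ∑' y : X d, (fun y => if y ∈ T then Bf y else 0) y ^ 2 = ∑ y ∈ T, Bf y ^ 2 := by
      rw [tsum_eq_sum hzero]
      exact Finset.sum_congr rfl fun y hy => by simp [hy]
    have h2 : ∀ z : X d, HBZd n a (fun y => if y ∈ T then Bf y else 0) z = HB n a T Bf z := fun z => by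
      unfold HBZd HB
      rw [tsum_eq_sum (s := T) (fun y hy => by simp [hy])]
      exact Finset.sum_congr rfl fun y hy => by simp [hy]
    have h3 := h _ hS
    simp_rw [h2, h1] at h3
    exact h3
  · intro hm Bf hB
    have hz : (0 : Fin d → ℝ) ∈ BZ d := ⟨fun _ => by simp [Real.pi_pos.le], fun _ => by simp [Real.pi_pos.le]⟩
    have h1K : 1 ≤ K := by have h0 := hm 0 hz; rwa [fibreRatio_zero] at h0
    have h2 := tsum_HBZd_sq_le_of_fibre n ha (by linarith) (fibre_hyp_of_ratio_le n ha hm) Bf hB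
    calc (((n : ℝ) + 1) ^ d)⁻¹ * ∑' z : X d, HBZd n a Bf z ^ 2
        ≤ (((n : ℝ) + 1) ^ d)⁻¹ * (((n : ℝ) + 1) ^ d * K * ∑' y : X d, Bf y ^ 2) :=
          mul_le_mul_of_nonneg_left h2 (inv_nonneg.mpr hN.le)
      _ = K * ∑' y : X d, Bf y ^ 2 := by field_simp


/-! ## §6. THE OPTIMAL CONSTANT EXISTS AND IS ATTAINED AT A MOMENTUM OF THE ZONE -/

/-- **THE LEAST CHART CONSTANT IS A MAXIMUM, ATTAINED**: there is `p⋆ ∈ [−π,π]^d` such that `Σ_kU_k(p⋆)R_k(p⋆)²∕X(p⋆)²` is the LEAST `K`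
with `((n+1)^d)⁻¹Σ′(HB)² ≤ K·Σ_T B²` for all finite windows — the fibre multiplier is continuous on the compact zone
(`IsCompact.exists_isMaxOn`), and `chart_letter_iff`. [folklore] -/
theorem exists_isLeast_chart_constant (n : ℕ) {a : ℝ} (ha : 0 < a) :
    ∃ p₀ ∈ BZ d, IsLeast {K : ℝ | ∀ (T : Finset (X d)) (Bf : X d → ℝ),
        (((n : ℝ) + 1) ^ d)⁻¹ * ∑' z : X d, HB n a T Bf z ^ 2 ≤ K * ∑ y ∈ T, Bf y ^ 2}
      ((∑ k : Fin d → Fin (n + 1), Ur (n + 1) k p₀ * Rr (n + 1) k p₀ ^ 2) / Xr (n + 1) p₀ ^ 2) := by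
  have hN : (0 : ℝ) < ((n : ℝ) + 1) ^ d := by positivity
  have hz : (0 : Fin d → ℝ) ∈ BZ d := ⟨fun _ => by simp [Real.pi_pos.le], fun _ => by simp [Real.pi_pos.le]⟩
  obtain ⟨p₀, hp₀, hmax⟩ := isCompact_BZ.exists_isMaxOn ⟨0, hz⟩ (continuousOn_mult n ha)
  have hmM : ∀ p ∈ BZ d, (∑ k : Fin d → Fin (n + 1), Ur (n + 1) k p * Rr (n + 1) k p ^ 2) / Xr (n + 1) p ^ 2
      = (∑ τ : Fin d → Fin (n + 1), ‖G (n + 1) a 0 τ (ofRealVec p) / symbQGQ (n + 1) a (ofRealVec p)‖ ^ 2)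
        / ((n : ℝ) + 1) ^ d := fun p hp => by
    rw [fibreMultiplier_eq n ha p hp]; field_simp
  refine ⟨p₀, hp₀, ?_, fun K hK => (chart_letter_iff n ha K).mp hK p₀ hp₀⟩
  refine (chart_letter_iff n ha _).mpr fun p hp => ?_
  rw [hmM p hp, hmM p₀ hp₀]
  exact div_le_div_of_nonneg_right (hmax hp) hN.le

/-- **the same for square-summable fields** (the shape of (42) `tsum_HBZd_sq_le_uniform_sharp`): the least constant of the `ℓ²` chart letter is
`max_{[−π,π]^d} Σ_kU_kR_k²∕X²`, attained at some `p⋆`. [folklore] -/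
theorem exists_isLeast_chart_constant_l2 (n : ℕ) {a : ℝ} (ha : 0 < a) :
    ∃ p₀ ∈ BZ d, IsLeast {K : ℝ | ∀ Bf : X d → ℝ, Summable (fun x => Bf x ^ 2) →
        (((n : ℝ) + 1) ^ d)⁻¹ * ∑' z : X d, HBZd n a Bf z ^ 2 ≤ K * ∑' y : X d, Bf y ^ 2}
      ((∑ k : Fin d → Fin (n + 1), Ur (n + 1) k p₀ * Rr (n + 1) k p₀ ^ 2) / Xr (n + 1) p₀ ^ 2) := by
  obtain ⟨p₀, hp₀, hleast⟩ := exists_isLeast_chart_constant (d := d) n ha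
  refine ⟨p₀, hp₀, ?_, fun K hK => hleast.2 ((chart_letter_iff n ha K).mpr ((chart_letter_l2_iff n ha K).mp hK))⟩
  exact (chart_letter_l2_iff n ha _).mpr ((chart_letter_iff n ha _).mp hleast.1)

end

end Summit.QuantumFields.BalabanUV.T4Continuum.NE7b.OneShotChartFibreSharp
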